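import Summits.BirchSwinnertonDyer.BirchSwinnertonDyer.Theorems.EisensteinPrimesGreenbergCorankAlgebra
import Summits.BirchSwinnertonDyer.BirchSwinnertonDyer.Theorems.EisensteinPrimesTwistDeformationLocalConditions
import HarnessLib

/-!
# Route `EisensteinPrimes` (rung K5), crux 2 `GoodLatticeBDPValue`, line `halves` v5, stub
# `stub_noPseudoNull`, road (γ): CRK(`𝐃`, `𝓛_𝔭`) for the specification "`⊤` at `𝔭`, `0`
# elsewhere" REDUCED to four corank inputs (helper for stmt-BirchSwinnertonDyer-19032)

Cell `bsd-eis`, seat `bsd-eis-k5-c2` (gen 8), k5-c2 lane of planner RULING L55 (A) (CRK bookkeeping);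
HOME/k5-c2-MEMO-8.md §3 (CRK). With the corank algebra of
`EisensteinPrimesGreenbergCorankAlgebra` (`hasCorank_pi_of_isCotorsion`, `CRK_of_hasCorank`):
`CRK_fullAt_of_coranks` — the hypothesis CRK(`𝐃`, `𝓛_𝔭`) of Greenberg 2016 Prop. 4.1.1 for
`𝓛_𝔭 = fullAtSpecification S ρ (Sum.inr 𝔭)` follows from `corank H¹(K_Σ/K, 𝐃) = 1`
(`hasCorank_H1_one_of_prop41`), `corank S_{𝓛_𝔭}(K, 𝐃) = 0` (the Shapiro bridge + BCGKPST §3.3 /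
Rubin 5.3 (iii): the `𝔭̄`-unramified Selmer group over the `ℤ_p²`-tower is cotorsion),
`corank H¹(K_𝔭̄, 𝐃) = 1` (`hasCorank_localH1_of_prop42_degree_one`) and the COTORSION of
`H¹(K_v, 𝐃)` at the remaining places of `Σ` (finite `v ∤ p`: corank `0` by Prop. 4.2 (b) +
cofinite generation [Gr4] Prop. 3.2; archimedean: `Γ_ℂ = 1`). `Σ` is finite (`finite_sigmaPlace`),
`Q_{𝓛_𝔭}(K_𝔭, 𝐃) = 0`, `Q_{𝓛_𝔭}(K_v, 𝐃) ≃ H¹(K_v, 𝐃)` elsewhere. §6 discharges the inputs `h₀ = 0`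
(global and local) for the TWIST DEFORMATION of a rank-one `A`: `hasCorank_H0_twistDeformation_zero`,
`hasCorank_localH0_twistDeformation_zero` (an element with `κ ≠ 0` acts as a scalar `≠ 1` of the
domain `Λ₂`, `twistDeformation_eq_smul` / `localRep_twistDeformation_eq_smul`). Theorems only; no named fact, no
`sorry`. HONEST FRAMING: closes nothing by itself (`--supports`); the four inputs stay named.
References: [Greenberg2016Selmer] §2.3 p. 7 (CRK), §1 p. 3 (`Q_𝓛 = Π_{v∈Σ} Q_𝓛(K_v, 𝐃)`).
-/

set_option autoImplicit false
set_option linter.dupNamespace false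

noncomputable section

open scoped Classical
open NumberField IsDedekindDomain Field
open Literature.NumberTheory.GaloisRepresentations Literature.NumberTheory.IwasawaTheory.Greenberg2016
  Literature.NumberTheory.IwasawaTheory.Greenberg2006

universe u

namespace Summit.BirchSwinnertonDyer.BirchSwinnertonDyer.Theorems.GreenbergFullAtSelmer

/-! ## §5 CRK for `𝓛_𝔭` from: `corank S_𝓛 = 0`, `corank H¹(K_Σ/K, 𝐃) = 1`, `corank H¹(K_𝔭̄, 𝐃) = 1`,
and cotorsion of the other local `H¹` -/

section FullAt

variable {K : Type u} [Field K] [NumberField K] {S : Set (HeightOneSpectrum (𝓞 K))}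
  {Λ : Type u} [CommRing Λ] [IsDomain Λ] [TopologicalSpace Λ]
  {D : Type u} [AddCommGroup D] [Module Λ D] [TopologicalSpace D] [DiscreteTopology D]
  [ContinuousSMul Λ D] {ρ : ContinuousRep (GaloisGroupUnramifiedOutside K S) Λ D}

omit [IsDomain Λ] in
/-- `Σ` (the finite places of `S` plus the archimedean places) is finite when `S` is.
[cite: Greenberg2016Selmer, §1 p. 3 L2–4] -/
theorem finite_sigmaPlace (hS : S.Finite) : Finite (SigmaPlace S) := by
  haveI : Finite S := hS
  let f : SigmaPlace S → InfinitePlace K ⊕ S := fun v ↦ match v with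
    | ⟨Sum.inl w, _⟩ => Sum.inl w
    | ⟨Sum.inr v, hv⟩ => Sum.inr ⟨v, (inSigma_inr_iff S v).mp hv⟩
  refine Finite.of_injective f ?_
  rintro ⟨w | v, hv⟩ ⟨w' | v', hv'⟩ h
  · simp only [f, Sum.inl.injEq] at h
    subst h; rfl
  · simp [f] at h
  · simp [f] at h
  · simp only [f, Sum.inr.injEq, Subtype.mk.injEq] at h
    subst h; rfl

/-- **CRK(`𝐃`, `𝓛_𝔭`) for the specification "`⊤` at `𝔭`, `0` elsewhere"** from four corank inputs:
`corank H¹(K_Σ/K, 𝐃) = 1` (`hasCorank_H1_one_of_prop41`), `corank S_{𝓛_𝔭}(K, 𝐃) = 0` (Rubin /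
BCGKPST: the `𝔭̄`-unramified Selmer group over the `ℤ_p²`-tower is cotorsion — through the Shapiro
bridge), `corank H¹(K_𝔭̄, 𝐃) = 1` (`hasCorank_localH1_of_prop42_degree_one`) at a second place
`𝔭̄ ≠ 𝔭` of `S`, and COTORSION of `H¹(K_v, 𝐃)` at every other place of `Σ` (finite `v ∈ S`: corank
`0` by Prop. 4.2 (b) plus cofinite generation, [Gr4] Prop. 3.2; archimedean `v`: `Γ_ℂ` trivial).
Then `corank Q_{𝓛_𝔭} = 1 = 0 + 1`. [cite: Greenberg2016Selmer, §2.3 p. 7 L7–17 (CRK), §1 p. 3 L23–25 (Q_𝓛 = Π Q_𝓛(K_v, 𝐃))] -/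
theorem CRK_fullAt_of_coranks (hS : S.Finite) {η η' : HeightOneSpectrum (𝓞 K)} (hη' : η' ∈ S)
    (hne : η' ≠ η) (hH1 : HasCorank Λ (ρ.H 1) 1)
    (hSel : HasCorank Λ (fullAtSpecification S ρ (Sum.inr η)).selmer 0)
    (hη'1 : HasCorank Λ ((localRep S ρ (Sum.inr η')).H 1) 1)
    (hcot : ∀ v : Place K, InSigma S v → v ≠ Sum.inr η → v ≠ Sum.inr η' →
      IsCotorsion Λ ((localRep S ρ v).H 1)) :
    (fullAtSpecification S ρ (Sum.inr η)).CRK := by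
  haveI := finite_sigmaPlace (K := K) hS
  haveI : Fintype (SigmaPlace S) := Fintype.ofFinite _
  refine CRK_of_hasCorank _ (s₀ := 0) (q₀ := 1) (by simpa using hH1) hSel ?_
  -- `Q_𝓛 = Π_v Q_v`, `Q_{η'} ≃ H¹(K_{η'}, 𝐃)` of corank 1, every other factor cotorsion
  refine hasCorank_pi_of_isCotorsion (S := fun v : SigmaPlace S ↦ (fullAtSpecification S ρ (Sum.inr η)).Q v.1)
    ⟨Sum.inr η', (inSigma_inr_iff S η').mpr hη'⟩ ?_ ?_
  · -- the factor at `η'`: `L = ⊥`, `Q ≃ H¹`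
    have hbot : fullAtSpecification S ρ (Sum.inr η) (Sum.inr η') = ⊥ :=
      fullAtSpecification_of_ne fun h ↦ hne (Sum.inr_injective h)
    exact hasCorank_of_linearEquiv (Submodule.quotEquivOfEqBot _ hbot).symm hη'1
  · rintro ⟨v, hv⟩ hvη'
    by_cases hvη : v = Sum.inr η
    · -- the factor at `η`: `L = ⊤`, `Q = 0`
      subst hvη
      haveI : Subsingleton ((fullAtSpecification S ρ (Sum.inr η)).Q (Sum.inr η)) :=
        Submodule.Quotient.subsingleton_iff.mpr (fullAtSpecification_self (Sum.inr η))
      exact isCotorsion_of_subsingleton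
    · have hbot : fullAtSpecification S ρ (Sum.inr η) v = ⊥ := fullAtSpecification_of_ne hvη
      have hne' : v ≠ Sum.inr η' := fun h ↦ hvη' (Subtype.ext h)
      intro Y _ _ toDual hY
      exact hcot v hv hvη hne' Y _
        (isDualPairing_precomp (Submodule.quotEquivOfEqBot _ hbot).symm hY)

end FullAt

/-! ## §6 `corank H⁰ = 0` for the twist deformation, globally and locally -/

section TwistH0

open PowerSeries Literature.NumberTheory.EllipticCurves
  Summit.BirchSwinnertonDyer.BirchSwinnertonDyer.Theorems.TwistDeformationCofree

variable {K : Type} [Field K] [NumberField K] (S : Set (HeightOneSpectrum (𝓞 K))) {p : ℕ} [Fact p.Prime]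
  {A : Type} [AddCommGroup A] [Module ℤ_[p] A] [TopologicalSpace A] [DiscreteTopology A]
  [TopologicalSpace (PowerSeries ℤ_[p])] [TopologicalSpace (PowerSeries (PowerSeries ℤ_[p]))]
  (hS : ∀ v : HeightOneSpectrum (𝓞 K), ((p : ℕ) : 𝓞 K) ∈ v.asIdeal → v ∈ S)
  (κ₁ κ₂ : ZpExtension K p) (ρ₀ : ContinuousRep (GaloisGroupUnramifiedOutside K S) ℤ_[p] A)

/-- `g ∈ G_{K,S}` acting on `A` by the scalar `t` acts on `𝐃` as `t · γ₁^{-κ₁ g} γ₂^{-κ₂ g} ∈ Λ₂` (the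
global twin of `localRep_twistDeformation_eq_smul`). [cite: Greenberg2006, p. 342 L1–11 (ρ = ρ₀ ⊗ κ^{-1})] -/
theorem twistDeformation_eq_smul (g : GaloisGroupUnramifiedOutside K S) {t : ℤ_[p]}
    (ht : ∀ a : A, ρ₀ g a = t • a) (Φ : IndModule₂ ℤ_[p] p A) :
    twistDeformation S hS κ₁ κ₂ ρ₀ g Φ =
      (PowerSeries.C (PowerSeries.C t) *
        (groupLike (PowerSeries ℤ_[p]) (-(κ₁.liftUnramifiedOutside S hS g).toAdd) *
          PowerSeries.C (groupLike ℤ_[p] (-(κ₂.liftUnramifiedOutside S hS g).toAdd)))) • Φ := by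
  ext x y
  rw [twistDeformation_apply, ht, mul_smul, IndModule₂.C_C_smul_apply, mul_smul,
    ← translate_eq_groupLike_smul, BigRepModule.translate_apply, BigRepModule.C_smul,
    BigRepModule.smul_apply, ← translate_eq_groupLike_smul, BigRepModule.translate_apply,
    ← sub_eq_add_neg, ← sub_eq_add_neg]

/-- **`corank_{Λ₂} H⁰(K_Σ/K, 𝐃) = 0` for the twist deformation of a rank-one `A`** (every `g ∈ G_{K,S}`
acting on `A` by a unit scalar — a character `θ`): some `g` has `κ₁(g) = γ₁ ≠ 1`
(`liftUnramifiedOutside_surjective`) and acts on `𝐃` as the scalar `tγ₁^{-1}γ₂^{-κ₂ g} ≠ 1` of the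
domain `Λ₂`. The input `h₀ = 0` of `hasCorank_H1_one_of_prop41`. [cite: Greenberg2006, Prop. 4.1 (§4 A, p. 367)] -/
theorem hasCorank_H0_twistDeformation_zero [IsTopologicalAddGroup (IndModule₂ ℤ_[p] p A)]
    [ContinuousSMul (PowerSeries (PowerSeries ℤ_[p])) (IndModule₂ ℤ_[p] p A)]
    (hscalar : ∀ g : GaloisGroupUnramifiedOutside K S, ∃ t : ℤ_[p]ˣ, ∀ a : A, ρ₀ g a = (t : ℤ_[p]) • a) :
    HasCorank (IwasawaAlgebra₂ p) ((twistDeformation S hS κ₁ κ₂ ρ₀).H 0) 0 := by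
  obtain ⟨g, hg⟩ := κ₁.liftUnramifiedOutside_surjective S hS (Multiplicative.ofAdd 1)
  obtain ⟨t, ht⟩ := hscalar g
  have hc : -(κ₁.liftUnramifiedOutside S hS g).toAdd ≠ 0 ∨ -(κ₂.liftUnramifiedOutside S hS g).toAdd ≠ 0 :=
    Or.inl (by rw [hg, toAdd_ofAdd]; norm_num)
  refine hasCorank_H0_zero_of_exists_smul _ (g := g) ?_ (twistDeformation_eq_smul S hS κ₁ κ₂ ρ₀ g ht)
  rw [Ne, show (1 : IwasawaAlgebra₂ p) = PowerSeries.C (PowerSeries.C (1 : ℤ_[p])) by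
    rw [map_one, map_one]]
  exact C_mul_groupLike_mul_ne_C t 1 hc

/-- **`corank_{Λ₂} H⁰(K_v, 𝐃) = 0` for the twist deformation at a place whose decomposition group has
non-trivial image in `Γ`** (`σ ∈ Γ_{K_v}` with `κ(σ) ≠ 0` acting on `A` by a unit scalar). The input
`h₀ = 0` of `hasCorank_localH1_of_prop42_degree_one` / `_zero_of_prop42`. [cite: Greenberg2006, Prop. 4.2 (§4 A, p. 368)] -/
theorem hasCorank_localH0_twistDeformation_zero [IsTopologicalAddGroup (IndModule₂ ℤ_[p] p A)]
    [ContinuousSMul (PowerSeries (PowerSeries ℤ_[p])) (IndModule₂ ℤ_[p] p A)]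
    (v : Place K) (σ : absoluteGaloisGroup v.Completion) (t : ℤ_[p]ˣ)
    (ht : ∀ a : A, ρ₀ (localToUnramified S v σ) a = (t : ℤ_[p]) • a)
    (hσ : κ₁ (absGaloisRestrict K v.Completion σ) ≠ 1 ∨ κ₂ (absGaloisRestrict K v.Completion σ) ≠ 1) :
    HasCorank (IwasawaAlgebra₂ p) ((localRep S (twistDeformation S hS κ₁ κ₂ ρ₀) v).H 0) 0 := by
  have hc : -(κ₁ (absGaloisRestrict K v.Completion σ)).toAdd ≠ 0 ∨
      -(κ₂ (absGaloisRestrict K v.Completion σ)).toAdd ≠ 0 := by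
    rcases hσ with h | h
    · exact Or.inl (neg_ne_zero.mpr fun h0 ↦ h (toAdd_eq_zero.mp h0))
    · exact Or.inr (neg_ne_zero.mpr fun h0 ↦ h (toAdd_eq_zero.mp h0))
  refine hasCorank_H0_zero_of_exists_smul _ (g := σ) ?_
    (localRep_twistDeformation_eq_smul S hS κ₁ κ₂ ρ₀ v σ ht)
  rw [Ne, show (1 : IwasawaAlgebra₂ p) = PowerSeries.C (PowerSeries.C (1 : ℤ_[p])) by
    rw [map_one, map_one]]
  exact C_mul_groupLike_mul_ne_C t 1 hc

end TwistH0

/-! ## §7 Cotorsion of `H¹(K_v, 𝐃)` at `v ∤ p` from Prop. 4.2 (b) and cofinite generation -/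

section LocalCotorsion

variable {p : ℕ} [Fact p.Prime] {K : Type} [Field K] [NumberField K]
  {S : Set (HeightOneSpectrum (𝓞 K))}
  {Λ : Type} [CommRing Λ] [IsDomain Λ] [TopologicalSpace Λ] [IsTopologicalRing Λ] {mΛ : ℕ}
  {D : Type} [AddCommGroup D] [Module Λ D] [TopologicalSpace D] [DiscreteTopology D]
  [ContinuousSMul Λ D] (ρ : ContinuousRep (GaloisGroupUnramifiedOutside K S) Λ D)

/-- **`H¹(K_v, 𝐃)` is cotorsion at a finite `v ∤ p`** with `corank H⁰(K_v, 𝐃) = corank H²(K_v, 𝐃) = 0`,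
granted Prop. 4.2 (b) (`corank H¹ = 0`) AND the cofinite generation of `H¹(K_v, 𝐃)` ([Gr4] Prop. 3.2,
taken as a hypothesis — not in the tree): the input `hcot` of `CRK_fullAt_of_coranks` at the
`θ`-ramified places. [cite: Greenberg2006, Prop. 4.2 (b) (§4 A, p. 368 L9–22), §4 p. 367 L33–39] -/
theorem isCotorsion_localH1_of_prop42 (h42 : prop42_localEulerPoincareCorank) (hSf : S.Finite)
    (hS : ∀ v : HeightOneSpectrum (𝓞 K), ((p : ℕ) : 𝓞 K) ∈ v.asIdeal → v ∈ S)
    (hΛ : Nonempty (Λ ≃+* MvPowerSeries (Fin mΛ) ℤ_[p]))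
    (hp : ∀ d : D, ∃ n : ℕ, (p ^ n : ℤ) • d = 0) (hcf : IsCofinitelyGenerated Λ D)
    {v : HeightOneSpectrum (𝓞 K)} (hv : ((p : ℕ) : 𝓞 K) ∉ v.asIdeal) {m : ℕ} (hm : HasCorank Λ D m)
    (h0 : HasCorank Λ ((localRep S ρ (Sum.inr v)).H 0) 0)
    (h2 : HasCorank Λ ((localRep S ρ (Sum.inr v)).H 2) 0)
    (hcfg : IsCofinitelyGenerated Λ ((localRep S ρ (Sum.inr v)).H 1)) :
    IsCotorsion Λ ((localRep S ρ (Sum.inr v)).H 1) :=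
  isCotorsion_of_isCofinitelyGenerated_of_hasCorank_zero hcfg
    (hasCorank_localH1_zero_of_prop42 ρ h42 hSf hS hΛ hp hcf hv hm h0 h2)

end LocalCotorsion

end Summit.BirchSwinnertonDyer.BirchSwinnertonDyer.Theorems.GreenbergFullAtSelmer

end
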